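import Mathlib
import Summits.ResolutionOfSingularities.ResolutionOfSingularities.Theorems.RadicialJungCleanModelsCleanProp44PointStep
import Summits.ResolutionOfSingularities.ResolutionOfSingularities.Theorems.RadicialJungCleanModelsCleanCurveTauTwoSlice
import HarnessLib

/-!
# Route `RadicialJung`, crux `CleanModels` (stmt-ResolutionOfSingularities-15917), line `Sketch` rev 35, stub 6 `stub_cleanProp44` (X44c):
# THE FULL CLEAN POINT STEP — near LINES handed to the CURVE SLICE

Seat decomp-res-hand-2 g16 (structural hand), sequel of ✓ `…CleanProp44PointStep.lean` (`exists_bad_near_point_of_forall_near_isClosed`: the clean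
point step WITHOUT lines).  Here case (P2) of the tree's point step ✓ `CP2008Prop44.exists_not_orderReducible_of_point_step` is re-threaded in clean
currency TOO: the near locus over `x` is a disjoint union of finitely many closed points and regular curves carrying r.s.p. coordinates (the landed
point-step bookkeeping ρ1′ ✓ `CP2008Prop44.stub_rho1'` = `pointStep_curves'`), so the near LINES are settled by the clean `τ ≥ 2` curve slice
✓ `exists_isCleanPermissibleSeq_lt_comap_of_curve_two_le_tau` or by THE CLEAN CURVE SLICE (R3) `hcurve` (= `hcurveTauOne` of
✓ `cleanProp44_of_tauOneResidual`, binders verbatim), and clean patching over a tidy stage ✓ `exists_isCleanPermissibleSeq_lt_of_pieces` replaces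
the pointwise patching.

* `exists_bad_near_point_of_curveSlice` — **THE FULL CLEAN POINT STEP**: `x` a closed threefold point of order `m`, isolated in the `m`-stratum of
  the open `W`, with NO clean sequence on `(W, J|_W, m)` for the line of `G|_W`; `π : X₁ → X` the blowing up at `x`; GIVEN the clean curve slice
  (R3) at the stage `X₁`.  Then some near closed threefold point `x'` over `x` with `τ = 1` (G-ring stalk), isolated in an open `W' ⊆ π⁻¹W`, again
  has no clean sequence on `(W', J₁|_{W'}, m)`.  So, GIVEN (R3), the clean `τ = 1` point game only ever continues through POINTS — and the companion
  file turns this into «(R2) ⟸ (R3)» by ✓ `CP2008Prop44.stub_T1`.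

Honest framing: OURS; (R3) is NOT proved here; nothing here proves X44c, any case of `CleanModels`, or resolution of singularities in
characteristic `p`. [cite: CossartPiltant2008, Prop. 4.2 (b), Lemma 4.3 (1)–(5), Prop. 4.4 (proof, pp. 10–11), Lemma 4.5]
[cite: Piltant2013, Prop. 5.1 (proof, Step 2)] [cite: GortzWedhorn2020, Prop. 13.91]
-/

noncomputable section

set_option linter.dupNamespace false -- mandated namespace of this single-conjunct summit

open CategoryTheory CategoryTheory.Limits AlgebraicGeometry TopologicalSpace IsLocalRing
open Literature.AlgebraicGeometry.Resolution Literature.AlgebraicGeometry.Motives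
open Scheme.IdealSheafData
open Summit.ResolutionOfSingularities.ResolutionOfSingularities.Theorems.CP2008Prop44

namespace Summit.ResolutionOfSingularities.ResolutionOfSingularities.Theorems.RadicialJung.CleanModels

/-! ## §0 Plumbing -/

/-- The stalk ideals of the zero ideal sheaf vanish. [folklore] -/
private theorem stalkIdeal_bot_pc {X : Scheme.{0}} (x : X) : stalkIdeal (⊥ : X.IdealSheafData) x = ⊥ := by
  obtain ⟨U, hU, hxU, -⟩ := exists_isAffineOpen_mem_and_subset (X := X) (x := x) (U := ⊤) (Opens.mem_top _)
  rw [stalkIdeal_eq_map_germ ⊥ ⟨U, hU⟩ hxU, Scheme.IdealSheafData.ideal_bot, Pi.bot_apply, Ideal.map_bot]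
/-- `ord_x(0) = ∞`. [folklore] -/
private theorem idealOrder_bot_eq_top_pc {X : Scheme.{0}} (x : X) : idealOrder (⊥ : X.IdealSheafData) x = ⊤ := by
  refine eq_top_iff.mpr (ENat.forall_natCast_le_iff_le.mp fun c _ => ?_)
  rw [le_idealOrder_iff, stalkIdeal_bot_pc]
  exact bot_le

/-! ## §1 The full clean point step -/

set_option maxHeartbeats 3200000 in
-- long: near-locus bookkeeping with curves, patching over the pieces of `π⁻¹W`, and the composition with the restricted blowing up
/-- **THE FULL CLEAN POINT STEP** (clean twin of ✓ `CP2008Prop44.exists_not_orderReducible_of_point_step`, both cases, the line case handed to the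
clean curve slice `hcurve`).  `X` integral Noetherian regular quasi-excellent of dimension `≤ 3`, `char K(X) = p`, the line of `G` clean-regular
everywhere; `(J, m)` with `m ≥ 1`, `ord ≤ m`, `V(J)` of codimension `≥ 2`; `W ∋ x` open, `x` a closed threefold point of order `m` isolated among the
points of order `≥ m` of `W`; `π : X₁ → X` a blowing up of `x`; no clean-permissible sequence for `(J|_W, m)` and the line of `G|_W` brings the order
below `m`; and the clean curve slice (R3) holds (hypothesis `hcurve`, binders of `hcurveTauOne` verbatim, for this `p` and `m`).  THEN some near
closed threefold point `x'` over `x` with `τ_{x'} = 1`, isolated among the points of order `≥ m` of an open `W' ⊆ π⁻¹W`, is such that no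
clean-permissible sequence for `(J₁|_{W'}, m)` and the line of `(π^♯G)|_{W'}` brings the order below `m`.
[cite: CossartPiltant2008, Prop. 4.4 (proof, pp. 10–11), Lemma 4.3 (1)–(5)] [cite: Piltant2013, Prop. 5.1 (proof, Step 2)] -/
theorem exists_bad_near_point_of_curveSlice {p : ℕ} (hp : p.Prime) {X : Scheme.{0}} [IsIntegral X] [IsNoetherian X]
    [hcharX : CharP X.functionField p] (hX : Scheme.IsRegular X) (hqe : Scheme.IsQuasiExcellent X)
    (hX3 : topologicalKrullDim X ≤ 3) (G : X.functionField)
    (hG : ∀ x : X, CleanRegAt p (algebraMap (X.presheaf.stalk x) X.functionField) G)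
    (J : X.IdealSheafData) {m : ℕ} (hm : 1 ≤ m) (hle : ∀ z, idealOrder J z ≤ m) (hcodim : ∀ z ∈ J.support, 1 < Order.coheight z)
    (W : X.Opens) (x : X) (hxW : x ∈ W) (hcl : IsClosed ({x} : Set X))
    (hbad : ∀ z : X, (m : ℕ∞) ≤ idealOrder J z → z = x ∨ z ∉ (W : Set X)) (hord : idealOrder J x = m)
    (hdim : (maximalIdeal (X.presheaf.stalk x)).spanFinrank = 3)
    {X₁ : Scheme.{0}} (π : X₁ ⟶ X) (hπ : IsBlowup π (vanishingIdeal ⟨{x}, hcl⟩))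
    (hcurve : ∀ {X : Scheme.{0}} [IsIntegral X] [IsNoetherian X], CharP X.functionField p →
      ∀ (hX : Scheme.IsRegular X), Scheme.IsQuasiExcellent X → topologicalKrullDim X ≤ 3 →
      ∀ (G : X.functionField), (∀ x : X, CleanRegAt p (algebraMap (X.presheaf.stalk x) X.functionField) G) →
      ∀ (J : X.IdealSheafData), (∀ z, idealOrder J z ≤ m) → (∀ z ∈ J.support, 1 < Order.coheight z) →
      ∀ (V : X.Opens) (Y : Closeds X), Scheme.IsRegular (vanishingIdeal Y).subscheme → IsIrreducible (Y : Set X) →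
      (Y : Set X) ⊆ (V : Set X) → (∀ z : X, (m : ℕ∞) ≤ idealOrder J z → z ∈ (Y : Set X) ∨ z ∉ (V : Set X)) →
      (∀ y ∈ (Y : Set X), idealOrder J y = m) →
      (∀ y ∈ (Y : Set X), haveI := hX y; ∃ c : Fin 2 → X.presheaf.stalk y, IsRsopPart c ∧
        Ideal.span (Set.range c) = stalkIdeal (vanishingIdeal Y) y) →
      (¬ ∀ y ∈ (Y : Set X), IsClosed ({y} : Set X) → haveI := hX y; 2 ≤ stalkTau J y m) →
      ∀ [IsIntegral ((V : X.Opens) : Scheme.{0})] [IsDominant V.ι],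
      ∃ (V' : Scheme.{0}) (π : V' ⟶ V) (_ : IsIntegral V') (_ : IsDominant π) (K' : V'.IdealSheafData),
        IsCleanPermissibleSeq p π (J.comap V.ι) m K' (RatFn.functionFieldMap V.ι G) ∧ ∀ y, idealOrder K' y < m)
    (hnot : ¬ ∀ [IsIntegral ((W : X.Opens) : Scheme.{0})] [IsDominant W.ι],
      ∃ (V' : Scheme.{0}) (ϖ : V' ⟶ W) (_ : IsIntegral V') (_ : IsDominant ϖ) (K' : V'.IdealSheafData),
        IsCleanPermissibleSeq p ϖ (J.comap W.ι) m K' (RatFn.functionFieldMap W.ι G) ∧ ∀ y, idealOrder K' y < m) :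
    ∃ (_ : IsIntegral X₁) (_ : IsNoetherian X₁) (hX₁ : Scheme.IsRegular X₁) (_ : Scheme.IsQuasiExcellent X₁)
      (_ : topologicalKrullDim X₁ ≤ 3) (_ : IsDominant π) (_ : CharP X₁.functionField p)
      (_ : ∀ x' : X₁, CleanRegAt p (algebraMap (X₁.presheaf.stalk x') X₁.functionField) (RatFn.functionFieldMap π G))
      (_ : ∀ z, idealOrder (controlledTransform π (vanishingIdeal ⟨{x}, hcl⟩) J m) z ≤ m)
      (_ : ∀ z ∈ (controlledTransform π (vanishingIdeal ⟨{x}, hcl⟩) J m).support, 1 < Order.coheight z)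
      (x' : X₁) (_ : π x' = x) (_ : IsNear π (vanishingIdeal ⟨{x}, hcl⟩) J m x') (W' : X₁.Opens) (_ : x' ∈ W')
      (_ : W' ≤ π ⁻¹ᵁ W) (_ : IsClosed ({x'} : Set X₁))
      (_ : ∀ z : X₁, (m : ℕ∞) ≤ idealOrder (controlledTransform π (vanishingIdeal ⟨{x}, hcl⟩) J m) z → z = x' ∨ z ∉ (W' : Set X₁))
      (_ : idealOrder (controlledTransform π (vanishingIdeal ⟨{x}, hcl⟩) J m) x' = m)
      (_ : (maximalIdeal (X₁.presheaf.stalk x')).spanFinrank = 3)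
      (_ : haveI := hX₁ x'; stalkTau (controlledTransform π (vanishingIdeal ⟨{x}, hcl⟩) J m) x' m = 1)
      (_ : IsGRing (X₁.presheaf.stalk x')),
      ¬ ∀ [IsIntegral ((W' : X₁.Opens) : Scheme.{0})] [IsDominant W'.ι],
        ∃ (V' : Scheme.{0}) (ϖ : V' ⟶ W') (_ : IsIntegral V') (_ : IsDominant ϖ) (K' : V'.IdealSheafData),
          IsCleanPermissibleSeq p ϖ ((controlledTransform π (vanishingIdeal ⟨{x}, hcl⟩) J m).comap W'.ι) m K'
            (RatFn.functionFieldMap W'.ι (RatFn.functionFieldMap π G)) ∧ ∀ y, idealOrder K' y < m := by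
  classical
  -- §a the blowing up and the invariants of `X₁`
  set D : Closeds X := ⟨{x}, hcl⟩ with hDdef
  have hDreg : Scheme.IsRegular (vanishingIdeal D).subscheme := CampaignW46.isRegular_subscheme_vanishingIdeal_singleton hcl
  have hDint : IsIntegral (vanishingIdeal D).subscheme := isIntegral_subscheme_vanishingIdeal_singleton hcl
  have hY : ∀ y ∈ (D : Set X), idealOrder J y = m := fun y hy => by
    rw [show y = x from hy]; exact hord
  have hDm : ∀ y ∈ (D : Set X), (m : ℕ∞) ≤ idealOrder J y := fun y hy => (hY y hy).ge
  have hJne : J ≠ ⊥ := ne_bot_of_forall_one_lt_coheight hcodim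
  have hDne : vanishingIdeal D ≠ ⊥ := vanishingIdeal_ne_bot_of_forall_idealOrder_eq hJne hm hY
  haveI hint₁ : IsIntegral X₁ := hπ.isIntegral hDne
  haveI hdomπ : IsDominant π := isDominant_of_isBlowup_of_ne_bot hπ hDne
  have hseq1 : CampaignW46.IsPermissibleBlowupSeq J m π (controlledTransform π (vanishingIdeal D) J m) :=
    CampaignW46.IsPermissibleBlowupSeq.single D π hDreg hDm hπ
  obtain ⟨-, hnoeth', hX', hqe', hle', hcodim'⟩ := IsPermissibleBlowupSeq.prop44Invariants hX hqe hm hle hcodim hseq1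
  haveI := hnoeth'
  have hX3' : topologicalKrullDim X₁ ≤ 3 := hπ.topologicalKrullDim_le hX3
  have hcoh3' : ∀ z : X₁, Order.coheight z ≤ 3 := (topologicalKrullDim_le_iff_forall_coheight_le X₁ 3).mp hX3'
  haveI : IsRegularLocalRing (X.presheaf.stalk x) := hX x
  haveI hcharX₁ : CharP X₁.functionField p := charP_of_injective_ringHom (RatFn.functionFieldMap π).injective p
  set J' := controlledTransform π (vanishingIdeal D) J m with hJ'def
  -- the one-step clean-permissible sequence on `X` and the clean data upstairs
  have hseqX : IsCleanPermissibleSeq p (π ≫ 𝟙 X) J m J' G :=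
    IsCleanPermissibleSeq.cons_point hp π (𝟙 X) J m J G (IsCleanPermissibleSeq.nil J m G) x hcl hDint hDreg hord hπ
      (by rw [RatFn.functionFieldMap_id]; exact hG x)
  have hseqX' : IsCleanPermissibleSeq p π J m J' G := by simpa only [Category.comp_id] using hseqX
  have hG₁ : ∀ z : X₁, CleanRegAt p (algebraMap (X₁.presheaf.stalk z) X₁.functionField) (RatFn.functionFieldMap π G) :=
    hseqX'.cleanRegAt hp hcharX hG
  -- §b the points of order `≥ m`: near points over `x`, or over the complement of `W`
  have hoff : ∀ z : X₁, π z ≠ x → (m : ℕ∞) ≤ idealOrder J' z → π z ∉ (W : Set X) := by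
    intro z hπz hz
    have hz' : π z ∉ ((vanishingIdeal D).support : Set X) := by
      rw [Scheme.IdealSheafData.coe_support_vanishingIdeal]; exact hπz
    rw [hJ'def, hπ.idealOrder_controlledTransform_of_not_mem J m hz'] at hz
    exact (hbad (π z) hz).elim (fun h => absurd h hπz) id
  have hnear_of : ∀ z : X₁, π z = x → (m : ℕ∞) ≤ idealOrder J' z → IsNear π (vanishingIdeal D) J m z := by
    intro z hπz hz
    have hle := hπ.idealOrder_controlledTransform_le_of_mem hX hDreg hY (x' := z) (by rw [hπz]; rfl)
    exact isNear_iff.mpr (le_antisymm hle hz)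
  -- §c the near locus over `x` and its maximal points
  set T₀ : Set X₁ := {z : X₁ | (m : ℕ∞) ≤ idealOrder J' z ∧ π z = x} with hT₀def
  have hJ'ne : J' ≠ ⊥ := ne_bot_of_forall_one_lt_coheight hcodim'
  have hOrdCl : IsClosed {z : X₁ | (m : ℕ∞) ≤ idealOrder J' z} :=
    isClosed_setOf_le_idealOrder_of_isJ2 hX' (fun U => (hqe' U).isJ2Ring) hJ'ne m
  have hT₀cl : IsClosed T₀ := by
    have h2 : IsClosed {z : X₁ | π z = x} := hcl.preimage π.continuous
    exact hOrdCl.inter h2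
  have hT₀W : T₀ ⊆ ((π ⁻¹ᵁ W : X₁.Opens) : Set X₁) := fun z hz => by
    show π z ∈ (W : Set X); rw [hz.2]; exact hxW
  have hT₀max : maxPoints T₀ ⊆ maxPoints {z : X₁ | (m : ℕ∞) ≤ idealOrder J' z} := by
    intro η hη
    refine ⟨hη.1.1, fun ζ hζ hζη => hη.2 ζ ⟨hζ, ?_⟩ hζη⟩
    by_contra hne
    have h1 := hoff ζ hne hζ
    have h2 : π ζ ⤳ π η := hζη.map π.continuous
    rw [hη.1.2] at h2
    exact h1 (h2.mem_open W.2 hxW)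
  have hcov : ∀ z : X₁, z ∈ ((π ⁻¹ᵁ W : X₁.Opens) : Set X₁) → (m : ℕ∞) ≤ idealOrder J' z → z ∈ T₀ := by
    intro z hzW hz
    refine ⟨hz, ?_⟩
    by_contra hne
    exact hoff z hne hz hzW
  -- §d the pieces: the closures of the (finitely many) maximal points of `T₀` (regular curves, equal or disjoint, by ρ1′)
  have hMfin : (maxPoints T₀).Finite := finite_maxPoints hT₀cl
  haveI : Fintype (maxPoints T₀) := hMfin.fintype
  obtain ⟨n, ⟨e⟩⟩ : ∃ n, Nonempty ((maxPoints T₀) ≃ Fin n) := ⟨_, ⟨Fintype.equivFin _⟩⟩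
  let η : Fin n → X₁ := fun i => ((e.symm i : maxPoints T₀) : X₁)
  have hηM : ∀ i, η i ∈ maxPoints T₀ := fun i => (e.symm i).2
  have hηinj : Function.Injective η := fun i j h => e.symm.injective (Subtype.ext h)
  let Z : Fin n → Set X₁ := fun i => closure {η i}
  have hZT : ∀ i, Z i ⊆ T₀ := fun i => closure_minimal (Set.singleton_subset_iff.mpr (hηM i).1) hT₀cl
  have hZc : ∀ i, IsClosed (Z i) := fun i => isClosed_closure
  have hρ : ∀ i, ¬ IsClosed ({η i} : Set X₁) →
      Scheme.IsRegular (vanishingIdeal (⟨closure {η i}, isClosed_closure⟩ : Closeds X₁)).subscheme ∧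
        (∀ y ∈ closure ({η i} : Set X₁), ∀ hr : IsRegularLocalRing (X₁.presheaf.stalk y),
          ∃ c : Fin 2 → X₁.presheaf.stalk y, @IsRsopPart _ _ _ 2 c ∧
            Ideal.span (Set.range c) = stalkIdeal (vanishingIdeal (⟨closure {η i}, isClosed_closure⟩ : Closeds X₁)) y) ∧
        ∀ j, ¬ IsClosed ({η j} : Set X₁) → η j = η i ∨ Disjoint (closure ({η i} : Set X₁)) (closure {η j}) := by
    intro i hi
    rcases stub_rho1' hX hX3 J hm hle hcodim hcl hord hdim hπ (hT₀max (hηM i)) hi with ⟨hne, -, -⟩ | ⟨-, hregi, hrsop, huniq⟩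
    · exact absurd (hηM i).1.2 hne
    · exact ⟨hregi, hrsop, fun j hj => huniq (η j) (hT₀max (hηM j)) hj (hηM j).1.2⟩
  have hdisj : ∀ i j, i ≠ j → Disjoint (Z i) (Z j) := by
    intro i j hij
    have hne : η i ≠ η j := fun h => hij (hηinj h)
    by_cases hi : IsClosed ({η i} : Set X₁)
    · have hZi : Z i = {η i} := hi.closure_eq
      rw [hZi]
      refine Set.disjoint_singleton_left.mpr fun h => hne ?_
      exact ((hηM i).2 (η j) (hηM j).1 (specializes_iff_mem_closure.mpr h)).symm
    · by_cases hj : IsClosed ({η j} : Set X₁)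
      · have hZj : Z j = {η j} := hj.closure_eq
        rw [hZj]
        refine Set.disjoint_singleton_right.mpr fun h => hne ?_
        exact (hηM j).2 (η i) (hηM i).1 (specializes_iff_mem_closure.mpr h)
      · rcases (hρ i hi).2.2 j hj with h | h
        · exact absurd h.symm hne
        · exact h
  have hcovZ : ∀ z : X₁, z ∈ ((π ⁻¹ᵁ W : X₁.Opens) : Set X₁) → (m : ℕ∞) ≤ idealOrder J' z → ∃ i, z ∈ Z i := by
    intro z hzW hz
    obtain ⟨ζ, hζM, hζz⟩ := exists_mem_maxPoints_specializes hT₀cl (hcov z hzW hz)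
    refine ⟨e ⟨ζ, hζM⟩, ?_⟩
    have hη : η (e ⟨ζ, hζM⟩) = ζ := by
      show ((e.symm (e ⟨ζ, hζM⟩) : maxPoints T₀) : X₁) = ζ
      rw [Equiv.symm_apply_apply]
    show z ∈ closure {η (e ⟨ζ, hζM⟩)}
    rw [hη]
    exact specializes_iff_mem_closure.mp hζz
  -- the isolating opens `V₁ i = π⁻¹W ∖ ⋃_{j ≠ i} Z j`
  have hrestcl : ∀ i : Fin n, IsClosed (⋃ j ∈ {j : Fin n | j ≠ i}, Z j) := fun i =>
    (Set.toFinite _).isClosed_biUnion fun j _ => hZc j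
  let V₁ : Fin n → X₁.Opens := fun i => ⟨((π ⁻¹ᵁ W : X₁.Opens) : Set X₁) \ ⋃ j ∈ {j : Fin n | j ≠ i}, Z j, (π ⁻¹ᵁ W).2.sdiff (hrestcl i)⟩
  have hV₁le : ∀ i, V₁ i ≤ π ⁻¹ᵁ W := fun i w hw => hw.1
  have hZV₁ : ∀ i, Z i ⊆ (V₁ i : Set X₁) := by
    intro i z hz
    refine ⟨hT₀W (hZT i hz), fun h => ?_⟩
    obtain ⟨j, hj, hzj⟩ := Set.mem_iUnion₂.mp h
    exact Set.disjoint_left.mp (hdisj i j (Ne.symm hj)) hz hzj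
  have hbadV₁ : ∀ i, ∀ z : X₁, (m : ℕ∞) ≤ idealOrder J' z → z ∈ Z i ∨ z ∉ (V₁ i : Set X₁) := by
    intro i z hz
    by_cases hzV : z ∈ (V₁ i : Set X₁)
    · left
      obtain ⟨j, hj⟩ := hcovZ z (hV₁le i hzV) hz
      by_cases hji : j = i
      · exact hji ▸ hj
      · exact absurd (Set.mem_iUnion₂.mpr ⟨j, hji, hj⟩) hzV.2
    · exact Or.inr hzV
  -- §e if every piece were settled on its isolating open, `(W, J|_W, m)` would be settled
  by_contra hnone
  push Not at hnone
  apply hnot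
  intro hWint hWdom
  have hsettled : ∀ i, ∀ [IsIntegral ((V₁ i : X₁.Opens) : Scheme.{0})] [IsDominant (V₁ i).ι],
      ∃ (V' : Scheme.{0}) (ϖ : V' ⟶ V₁ i) (_ : IsIntegral V') (_ : IsDominant ϖ) (K' : V'.IdealSheafData),
        IsCleanPermissibleSeq p ϖ (J'.comap (V₁ i).ι) m K' (RatFn.functionFieldMap (V₁ i).ι (RatFn.functionFieldMap π G)) ∧
          ∀ y, idealOrder K' y < m := by
    intro i _ _
    have hπη : π (η i) = x := (hηM i).1.2
    by_cases hi : IsClosed ({η i} : Set X₁)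
    · -- a closed near point: settled by the hypothesis of the contradiction (`τ = 1`) or by the clean `τ ≥ 2` slice
      have hZi : Z i = {η i} := hi.closure_eq
      have hnear : IsNear π (vanishingIdeal D) J m (η i) := hnear_of _ hπη (hηM i).1.1
      have hordη : idealOrder J' (η i) = m := isNear_iff.mp hnear
      haveI : IsRegularLocalRing (X₁.presheaf.stalk (η i)) := hX' _
      haveI : IsRegularLocalRing (X.presheaf.stalk (π (η i))) := hX _
      have hdimη : (maximalIdeal (X₁.presheaf.stalk (η i))).spanFinrank = 3 :=
        spanFinrank_eq_three_of_isClosed hπ hi (by rw [CampaignW46.spanFinrank_maximalIdeal_congr hπη]; exact hdim)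
      have hGη : IsGRing (X₁.presheaf.stalk (η i)) := Scheme.isGRing_stalk_of_isQuasiExcellent hqe' _
      have hηV : η i ∈ V₁ i := hZV₁ i (by rw [hZi]; exact Set.mem_singleton _)
      have hbadV' : ∀ z : X₁, (m : ℕ∞) ≤ idealOrder J' z → z = η i ∨ z ∉ (V₁ i : Set X₁) := fun z hz =>
        (hbadV₁ i z hz).imp (fun h => by rw [hZi] at h; exact h) id
      by_cases hτi : stalkTau J' (η i) m = 1
      · exact hnone hint₁ hnoeth' hX' hqe' hX3' hdomπ hcharX₁ hG₁ hle' hcodim' (η i) hπη hnear (V₁ i) hηV (hV₁le i) hi hbadV' hordη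
          hdimη hτi hGη
      · have hτ2 : 2 ≤ stalkTau J' (η i) m := by
          have h : 1 ≤ stalkTau J' (η i) m := hnear.one_le_stalkTau hm
          omega
        exact exists_isCleanPermissibleSeq_lt_comap_of_isolated_two_le_tau hp hX' J' hm (RatFn.functionFieldMap π G) hG₁ (V₁ i) (η i)
          hηV hi hbadV' hordη hdimη hτ2 hGη
    · -- a near curve (regular, with r.s.p. coordinates, by ρ1′): settled by the clean `τ ≥ 2` curve slice or by the curve slice `hcurve`
      obtain ⟨hregL, hrsop, -⟩ := hρ i hi
      have hsupp : η i ∈ J'.support := by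
        rw [← one_le_idealOrder_iff]
        exact le_trans (by exact_mod_cast hm) (hηM i).1.1
      have hirr : IsIrreducible ((⟨closure {η i}, isClosed_closure⟩ : Closeds X₁) : Set X₁) := isIrreducible_singleton.closure
      have hordZ : ∀ y ∈ ((⟨closure {η i}, isClosed_closure⟩ : Closeds X₁) : Set X₁), idealOrder J' y = m := fun y hy =>
        le_antisymm (hle' y) (hZT i hy).1
      have hrsop' : ∀ y ∈ ((⟨closure {η i}, isClosed_closure⟩ : Closeds X₁) : Set X₁), haveI := hX' y;
          ∃ c : Fin 2 → X₁.presheaf.stalk y, IsRsopPart c ∧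
            Ideal.span (Set.range c) = stalkIdeal (vanishingIdeal (⟨closure {η i}, isClosed_closure⟩ : Closeds X₁)) y :=
        fun y hy => hrsop y hy (hX' y)
      by_cases hτ2 : ∀ y ∈ ((⟨closure {η i}, isClosed_closure⟩ : Closeds X₁) : Set X₁), IsClosed ({y} : Set X₁) →
          haveI := hX' y; 2 ≤ stalkTau J' y m
      · exact exists_isCleanPermissibleSeq_lt_comap_of_curve_two_le_tau hp hX' hqe' hX3' (RatFn.functionFieldMap π G) hG₁ J' hm hle'
          (V₁ i) ⟨closure {η i}, isClosed_closure⟩ hirr (hZV₁ i) (hbadV₁ i) hordZ hrsop' hτ2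
      · exact hcurve hcharX₁ hX' hqe' hX3' (RatFn.functionFieldMap π G) hG₁ J' hle' hcodim' (V₁ i) ⟨closure {η i}, isClosed_closure⟩
          hregL hirr (hZV₁ i) (hbadV₁ i) hordZ hrsop' hτ2
  -- §f the restricted blowing up `π|_W : U = π⁻¹W → W`, clean-permissible, and its transforms
  set U : X₁.Opens := π ⁻¹ᵁ W with hUdef
  -- the restricted blowing up `π|_W : U → W` is the blowing up of `W` at `x`
  set x₀ : (W : Scheme.{0}) := ⟨x, hxW⟩ with hx₀def
  have hιx₀ : W.ι x₀ = x := by simp [hx₀def, Scheme.Opens.ι_apply]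
  have hclW : IsClosed ({x₀} : Set (W : Scheme.{0})) := by
    have : ({x₀} : Set (W : Scheme.{0})) = W.ι ⁻¹' {x} := by
      ext w
      simp only [Set.mem_singleton_iff, Set.mem_preimage]
      constructor
      · rintro rfl; exact hιx₀
      · intro h; exact W.ι.isOpenEmbedding.injective (h.trans hιx₀.symm)
    rw [this]
    exact hcl.preimage W.ι.continuous
  have hpre : D.preimage W.ι.continuous = (⟨{x₀}, hclW⟩ : Closeds (W : Scheme.{0})) := by
    apply Closeds.ext
    ext w
    simp only [Closeds.coe_preimage, Set.mem_preimage, hDdef, Closeds.coe_mk, Set.mem_singleton_iff]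
    constructor
    · intro h; exact W.ι.isOpenEmbedding.injective (h.trans hιx₀.symm)
    · rintro rfl; exact hιx₀
  have hCW : (vanishingIdeal D).comap W.ι = vanishingIdeal ⟨{x₀}, hclW⟩ := by
    rw [comap_vanishingIdeal_of_isOpenImmersion W.ι D, hpre]
  have hπW : IsBlowup (π ∣_ W) (vanishingIdeal ⟨{x₀}, hclW⟩) := by
    rw [← hCW]; exact hπ.restrict W
  -- `W` inherits the standing hypotheses needed by `cons_point`
  haveI : IsLocallyNoetherian ((W : X.Opens) : Scheme.{0}) := LocallyOfFiniteType.isLocallyNoetherian W.ι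
  haveI hcharW : CharP (W : Scheme.{0}).functionField p := charP_of_injective_ringHom (RatFn.functionFieldMap W.ι).injective p
  have hordx₀ : idealOrder (J.comap W.ι) x₀ = m := by rw [idealOrder_comap_of_isOpenImmersion W.ι J x₀, hιx₀, hord]
  have hJWne : J.comap W.ι ≠ ⊥ := by
    intro h
    have h1 := hordx₀
    rw [h, idealOrder_bot_eq_top_pc] at h1
    exact ENat.top_ne_coe m h1
  have hx₀Y : ∀ y ∈ ((⟨{x₀}, hclW⟩ : Closeds (W : Scheme.{0})) : Set (W : Scheme.{0})), idealOrder (J.comap W.ι) y = m :=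
    forall_mem_closeds_singleton_idealOrder_eq hclW hordx₀
  have hx₀ne : vanishingIdeal (⟨{x₀}, hclW⟩ : Closeds (W : Scheme.{0})) ≠ ⊥ :=
    vanishingIdeal_ne_bot_of_forall_idealOrder_eq hJWne hm hx₀Y
  haveI hUint : IsIntegral ((U : X₁.Opens) : Scheme.{0}) := hπW.isIntegral hx₀ne
  haveI hπWdom : IsDominant (π ∣_ W) := isDominant_of_isBlowup_of_ne_bot hπW hx₀ne
  haveI : IsDominant U.ι := isDominant_of_isOpenImmersion _
  haveI : IsLocallyNoetherian ((U : X₁.Opens) : Scheme.{0}) := LocallyOfFiniteType.isLocallyNoetherian U.ι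
  have hseqW : IsCleanPermissibleSeq p ((π ∣_ W) ≫ 𝟙 (W : Scheme.{0})) (J.comap W.ι) m
      (controlledTransform (π ∣_ W) (vanishingIdeal ⟨{x₀}, hclW⟩) (J.comap W.ι) m) (RatFn.functionFieldMap W.ι G) :=
    IsCleanPermissibleSeq.cons_point hp (π ∣_ W) (𝟙 _) (J.comap W.ι) m (J.comap W.ι) (RatFn.functionFieldMap W.ι G)
      (IsCleanPermissibleSeq.nil _ m _) x₀ hclW (isIntegral_subscheme_vanishingIdeal_singleton hclW)
      (CampaignW46.isRegular_subscheme_vanishingIdeal_singleton hclW) hordx₀ hπW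
      (by rw [RatFn.functionFieldMap_id]; exact CleanRegAt.functionFieldMap_of_isIso_stalkMap W.ι x₀ (hιx₀ ▸ hG x))
  have hsq : U.ι ≫ π = (π ∣_ W) ≫ W.ι := (morphismRestrict_ι π W).symm
  have hCT : J'.comap U.ι = controlledTransform (π ∣_ W) (vanishingIdeal ⟨{x₀}, hclW⟩) (J.comap W.ι) m := by
    rw [← hCW, hJ'def]
    exact comap_controlledTransform_of_flat W.ι hsq (vanishingIdeal D) J m
  have hseqW' : IsCleanPermissibleSeq p (π ∣_ W) (J.comap W.ι) m (J'.comap U.ι) (RatFn.functionFieldMap W.ι G) := by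
    rw [hCT]
    simpa only [Category.comp_id] using hseqW
  have hGU : RatFn.functionFieldMap U.ι (RatFn.functionFieldMap π G) = RatFn.functionFieldMap (π ∣_ W) (RatFn.functionFieldMap W.ι G) := by
    rw [← RingHom.comp_apply, ← RatFn.functionFieldMap_comp, RatFn.functionFieldMap_congr hsq, RatFn.functionFieldMap_comp,
      RingHom.comp_apply]
  -- §g the conclusion on `U`, by clean patching over the pieces `Z i` (pulled back to `U`)
  have hU : ∃ (U' : Scheme.{0}) (ϖ : U' ⟶ U) (_ : IsIntegral U') (_ : IsDominant ϖ) (K' : U'.IdealSheafData),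
      IsCleanPermissibleSeq p ϖ (J'.comap U.ι) m K' (RatFn.functionFieldMap U.ι (RatFn.functionFieldMap π G)) ∧
        ∀ y, idealOrder K' y < m := by
    refine exists_isCleanPermissibleSeq_lt_of_pieces (J'.comap U.ι) m (RatFn.functionFieldMap U.ι (RatFn.functionFieldMap π G))
      (fun i => U.ι ⁻¹' Z i) (fun i => (hZc i).preimage U.ι.continuous) (fun i j hij => ?_) (fun u hu => ?_) (fun i V hV => ?_)
    · exact Set.disjoint_left.mpr fun u hui huj => Set.disjoint_left.mp (hdisj i j hij) hui huj
    · rw [idealOrder_comap_of_isOpenImmersion U.ι J' u] at hu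
      have hmem : U.ι u ∈ ((U : X₁.Opens) : Set X₁) := by rw [← Scheme.Opens.range_ι U]; exact ⟨u, rfl⟩
      obtain ⟨i, hi⟩ := hcovZ _ hmem hu
      exact ⟨i, hi⟩
    · intro _ _
      -- `V = U ∖ ⋃_{j ≠ i} U.ι⁻¹ Z j` maps into `V₁ i` by an open immersion
      haveI : Nonempty ((V₁ i : X₁.Opens) : Scheme.{0}) := ⟨⟨η i, hZV₁ i (subset_closure rfl)⟩⟩
      haveI : IsIntegral ((V₁ i : X₁.Opens) : Scheme.{0}) := isIntegral_of_isOpenImmersion (V₁ i).ι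
      haveI : IsDominant (V₁ i).ι := isDominant_of_isOpenImmersion _
      haveI : IsLocallyNoetherian ((V₁ i : X₁.Opens) : Scheme.{0}) := LocallyOfFiniteType.isLocallyNoetherian (V₁ i).ι
      have hrange : Set.range (V.ι ≫ U.ι).base ⊆ Set.range (V₁ i).ι.base := by
        rintro _ ⟨w, rfl⟩
        rw [Scheme.Opens.range_ι]
        have hw : (w.1 : (U : Scheme.{0})) ∈ (V : Set (U : Scheme.{0})) := w.2
        rw [hV] at hw
        have hwU : U.ι w.1 ∈ ((U : X₁.Opens) : Set X₁) := by rw [← Scheme.Opens.range_ι U]; exact ⟨w.1, rfl⟩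
        show U.ι w.1 ∈ (V₁ i : Set X₁)
        refine ⟨hwU, fun h => hw ?_⟩
        obtain ⟨j, hj, hzj⟩ := Set.mem_iUnion₂.mp h
        exact Set.mem_iUnion₂.mpr ⟨j, hj, hzj⟩
      set e₁ : ((V : U.toScheme.Opens) : Scheme.{0}) ⟶ (V₁ i : Scheme.{0}) := IsOpenImmersion.lift (V₁ i).ι (V.ι ≫ U.ι) hrange
        with he₁def
      have he₁ : e₁ ≫ (V₁ i).ι = V.ι ≫ U.ι := IsOpenImmersion.lift_fac _ _ _
      haveI : IsOpenImmersion (e₁ ≫ (V₁ i).ι) := by rw [he₁]; infer_instance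
      haveI : IsOpenImmersion e₁ := IsOpenImmersion.of_comp e₁ (V₁ i).ι
      haveI : IsDominant e₁ := isDominant_of_isOpenImmersion _
      obtain ⟨V', ϖ, hV', hϖ, K', hseq, hlt⟩ := exists_isCleanPermissibleSeq_lt_of_isOpenImmersion e₁ (hsettled i)
      refine ⟨V', ϖ, hV', hϖ, K', ?_, hlt⟩
      have hJ'' : (J'.comap (V₁ i).ι).comap e₁ = (J'.comap U.ι).comap V.ι := by
        rw [← Scheme.IdealSheafData.comap_comp, ← Scheme.IdealSheafData.comap_comp, he₁]
      have hG'' : RatFn.functionFieldMap e₁ (RatFn.functionFieldMap (V₁ i).ι (RatFn.functionFieldMap π G)) =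
          RatFn.functionFieldMap V.ι (RatFn.functionFieldMap U.ι (RatFn.functionFieldMap π G)) := by
        rw [← RingHom.comp_apply, ← RatFn.functionFieldMap_comp, RatFn.functionFieldMap_congr he₁, RatFn.functionFieldMap_comp,
          RingHom.comp_apply]
      rw [hJ'', hG''] at hseq
      exact hseq
  -- compose with the restricted blowing up
  obtain ⟨U', ϖ, hU', hϖ, K', hseqU, hlt⟩ := hU
  haveI := hU'; haveI := hϖ
  exact ⟨U', ϖ ≫ (π ∣_ W), inferInstance, inferInstance, K', hseqW'.comp hseqU hGU, hlt⟩

end Summit.ResolutionOfSingularities.ResolutionOfSingularities.Theorems.RadicialJung.CleanModels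

end
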